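import Summits.Ventures.YMGap.RobustBall.MassGapOnBallZdG
import HarnessLib

/-!
# Venture YMGap, track ROBUST-BALL — the VAN HOVE JOIN, step 1: boxes of `ℤ^d` on which reduction mod `L` is
# injective, and the BOX FAMILY of active interaction sets of a member (definitions + bookkeeping)

HONEST FRAMING. WHAT THIS IS: a venture file (cell `pub-ymgap`, track Y2 ROBUST-BALL, seat ds-3): finite
bookkeeping on `ℤ^d`, no probability. For the identification of the track's two currencies — DLR states of
a member `(W, supp)` of the `ℤ^d` ball on the one hand, infinite-volume limit states of perturbed TORUS
states on the other — a member is put on the torus of side `L + 1` by keeping exactly its ACTIVE listed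
interaction sets whose links are all based in the centred box `siteBox (L/2) = {x : |x_i| ≤ L/2 ∀ i}`, on which
reduction mod `L + 1` is injective (`injOn_proj_siteBox`), and reading them through the periodic lift (ds-2's
`chartMember`, next file). This file defines the box `siteBox n`, its links `boxLinks n`, the ACTIVE FAMILY
`activeFamily W supp Λ` of a finite volume (the listed sets meeting `Λ` with a nonzero term — exactly the index
set of the finite-volume Hamiltonian) and the BOX FAMILY `boxFamily W supp n` (the active listed sets with all
links based in `siteBox n`), and proves: every finite site set lies in `siteBox (L/2)` for all large `L`
(`eventually_subset_siteBox`); an active set containing a link is listed at that link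
(`mem_supp_singleton_of_active`), hence has `ℓ^∞` diameter `≤ R` under the member's range condition
(`diam_le_of_active`); the active family of `Λ` is inside the box family once the box contains the
`R`-neighbourhood of `Λ` (`activeFamily_subset_boxFamily`); a box set outside the active family of `Λ` misses
`Λ` (`disjoint_of_mem_boxFamily_of_not_mem_activeFamily`); and the load index sets of the box family are
inside those of the member (`filter_mem_boxFamily_subset`, `filter_base_boxFamily_subset_listedAt`), so the
`ℤ^d` loads of `MemBallZdG` dominate the loads of the box family. WHAT THIS IS NOT: no measure, no kernel, no
limit; nothing about the continuum or the Clay Millennium problem.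

References: H.-O. Georgii, Gibbs Measures and Phase Transitions (2011), §1.2, (2.11), Ex. 2.12 (finite-range
potentials, periodic boundary conditions); ds-2 `StarChartMember.lean` (the chart member this family feeds);
rb-p1 `MassGapOnBall.lean` / ds-2 `MassGapOnBallZdG.lean` (the balls `MemBallZd`, `MemBallZdG`).
-/

noncomputable section

open Function Finset Filter
open Literature.Probability.LatticeModels
open Literature.Probability.LatticeModels.DobrushinMetric
open Literature.MathematicalPhysics.QuantumLattice
open Literature.MathematicalPhysics.QuantumFieldTheory hiding ZdEdge Site

namespace Summit.Ventures.YMGap.RobustBall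

variable {d N : ℕ}

/-! ### Centred boxes of `ℤ^d` and injectivity of the reduction mod `L` -/

/-- **The centred box of radius `n`**: the sites `x ∈ ℤ^d` with `|x_i| ≤ n` for every coordinate `i`.
[folklore] -/
def siteBox (d n : ℕ) : Finset (Site d) := Fintype.piFinset fun _ : Fin d => Finset.Icc (-(n : ℤ)) n

/-- Membership in the box, coordinatewise. [folklore] -/
theorem mem_siteBox {n : ℕ} {x : Site d} : x ∈ siteBox d n ↔ ∀ i, |x i| ≤ n := by
  simp only [siteBox, Fintype.mem_piFinset, Finset.mem_Icc, abs_le]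

/-- Membership in the box through the sup norm: `x ∈ siteBox n ↔ ‖x‖ ≤ n`. [folklore] -/
theorem mem_siteBox_iff_norm {n : ℕ} {x : Site d} : x ∈ siteBox d n ↔ ‖x‖ ≤ n := by
  rw [mem_siteBox, pi_norm_le_iff_of_nonneg (Nat.cast_nonneg n)]
  refine forall_congr' fun i => ?_
  rw [Int.norm_eq_abs, ← Int.cast_abs]
  exact_mod_cast Iff.rfl

/-- A site within sup-distance `R` of a site of norm `≤ n - R` lies in the box of radius `n`. [folklore] -/
theorem mem_siteBox_of_norm_sub_le {n : ℕ} {R : ℝ} {x y : Site d} (hx : ‖x‖ + R ≤ n) (hy : ‖x - y‖ ≤ R) :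
    y ∈ siteBox d n := by
  rw [mem_siteBox_iff_norm]
  calc ‖y‖ = ‖x - (x - y)‖ := by rw [sub_sub_cancel]
    _ ≤ ‖x‖ + ‖x - y‖ := norm_sub_le _ _
    _ ≤ n := by linarith

/-- **Reduction mod `L` is injective on the box of radius `n` as soon as `2n < L`.** [folklore] -/
theorem injOn_proj_siteBox {n L : ℕ} (h : 2 * n < L) : Set.InjOn (Torus.proj L) (siteBox d n : Set (Site d)) := by
  intro x hx y hy hxy
  rw [Finset.mem_coe, mem_siteBox] at hx hy
  funext i
  have h1 : ((x i : ℤ) : ZMod L) = ((y i : ℤ) : ZMod L) := congr_fun hxy i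
  rw [ZMod.intCast_eq_intCast_iff_dvd_sub] at h1
  have h3 : |y i - x i| < (L : ℤ) := by
    have hxi := hx i
    have hyi := hy i
    have h2 : |y i - x i| ≤ 2 * (n : ℤ) := by
      rw [abs_le] at hxi hyi ⊢
      constructor <;> linarith [hxi.1, hxi.2, hyi.1, hyi.2]
    exact lt_of_le_of_lt h2 (by exact_mod_cast h)
  have := Int.eq_zero_of_abs_lt_dvd h1 h3
  omega

/-- The periodisation box at torus size `L + 1` has radius `L / 2`, and `mod (L+1)` is injective on it.
[folklore] -/
theorem injOn_proj_siteBox_half (L : ℕ) : Set.InjOn (Torus.proj (L + 1)) (siteBox d (L / 2) : Set (Site d)) :=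
  injOn_proj_siteBox (by omega)

/-- **Every finite site set lies in the box `siteBox (L/2)` for all large `L`**, with room `R` to spare:
eventually `‖x‖ + R ≤ L/2` for every `x ∈ S`. [folklore] -/
theorem eventually_norm_add_le (S : Finset (Site d)) (R : ℝ) :
    ∀ᶠ L : ℕ in atTop, ∀ x ∈ S, ‖x‖ + R ≤ ((L / 2 : ℕ) : ℝ) := by
  refine (Filter.eventually_all_finset S).2 fun x _ => ?_
  obtain ⟨K, hK⟩ := exists_nat_ge (‖x‖ + R)
  refine eventually_atTop.2 ⟨2 * K, fun L hL => hK.trans ?_⟩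
  have : K ≤ L / 2 := by omega
  exact_mod_cast this

/-- Every finite site set lies in `siteBox (L/2)` for all large `L`. [folklore] -/
theorem eventually_subset_siteBox (S : Finset (Site d)) : ∀ᶠ L : ℕ in atTop, S ⊆ siteBox d (L / 2) := by
  filter_upwards [eventually_norm_add_le S 0] with L hL x hx
  exact mem_siteBox_of_norm_sub_le (hL x hx) (by rw [sub_self, norm_zero])

/-- **The links based in the box.** [folklore] -/
def boxLinks (d n : ℕ) : Finset (ZdEdge d) := siteBox d n ×ˢ Finset.univ

/-- Membership in `boxLinks`. [folklore] -/
@[simp] theorem mem_boxLinks {n : ℕ} {e : ZdEdge d} : e ∈ boxLinks d n ↔ e.1 ∈ siteBox d n := by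
  simp [boxLinks]

/-! ### The active family of a volume and the box family of a member -/

section Families

variable (W : Potential (ZdEdge d) (SUN N)) (supp : Finset (ZdEdge d) → Finset (Finset (ZdEdge d)))

open Classical in
/-- **The ACTIVE FAMILY of the finite volume `Λ`**: the listed sets of `supp Λ` meeting `Λ` with a nonzero term —
the index set of the finite-volume Hamiltonian `H^W_Λ` with the inactive sets removed. [folklore] -/
def activeFamily (Λ : Finset (ZdEdge d)) : Finset (Finset (ZdEdge d)) :=
  (supp Λ).filter fun X => (X ∩ Λ).Nonempty ∧ W X ≠ 0

open Classical in
/-- **The BOX FAMILY at radius `n`**: the ACTIVE listed sets (nonzero term) all of whose links are based in the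
box `siteBox n` — the interaction sets the member keeps on the torus in the periodisation. [folklore] -/
def boxFamily (n : ℕ) : Finset (Finset (ZdEdge d)) :=
  (supp (boxLinks d n)).filter fun X => (∀ e ∈ X, e.1 ∈ siteBox d n) ∧ W X ≠ 0

variable {W supp}

/-- Membership in the active family (the shape of ds-2's `integral_perturbedYM_torusLift_eq`). [folklore] -/
theorem mem_activeFamily {Λ X : Finset (ZdEdge d)} :
    X ∈ activeFamily W supp Λ ↔ X ∈ supp Λ ∧ (X ∩ Λ).Nonempty ∧ W X ≠ 0 := by
  classical
  exact Finset.mem_filter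

/-- Membership in the box family. [folklore] -/
theorem mem_boxFamily {n : ℕ} {X : Finset (ZdEdge d)} :
    X ∈ boxFamily W supp n ↔ X ∈ supp (boxLinks d n) ∧ (∀ e ∈ X, e.1 ∈ siteBox d n) ∧ W X ≠ 0 := by
  classical
  exact Finset.mem_filter

/-- The links of a box set are based in the box. [folklore] -/
theorem base_mem_siteBox_of_mem_boxFamily {n : ℕ} {X : Finset (ZdEdge d)} (hX : X ∈ boxFamily W supp n)
    {e : ZdEdge d} (he : e ∈ X) : e.1 ∈ siteBox d n :=
  (mem_boxFamily.1 hX).2.1 e he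

/-- A box set has a nonzero term. [folklore] -/
theorem ne_zero_of_mem_boxFamily {n : ℕ} {X : Finset (ZdEdge d)} (hX : X ∈ boxFamily W supp n) : W X ≠ 0 :=
  (mem_boxFamily.1 hX).2.2

/-- **An active set is listed at each of its links** (local finiteness `Potential.IsSupportedBy` in the volume
`{e}`). [folklore] -/
theorem mem_supp_singleton_of_active (hsupp : W.IsSupportedBy supp) {X : Finset (ZdEdge d)} (hX : W X ≠ 0)
    {e : ZdEdge d} (he : e ∈ X) : X ∈ supp {e} :=
  hsupp {e} X ⟨e, Finset.mem_inter.2 ⟨he, Finset.mem_singleton_self e⟩⟩ hX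

/-- **An active set has `ℓ^∞` diameter `≤ R`** under the member's range condition (listed sets through a link
stay within `R` of it). [folklore] -/
theorem diam_le_of_active (hsupp : W.IsSupportedBy supp) {R : ℝ}
    (hrange : ∀ e, ∀ X ∈ supp {e}, e ∈ X → ∀ y ∈ X, ‖e.1 - y.1‖ ≤ R) {X : Finset (ZdEdge d)} (hX : W X ≠ 0) :
    ∀ a ∈ X, ∀ b ∈ X, ‖a.1 - b.1‖ ≤ R := fun a ha b hb =>
  hrange a X (mem_supp_singleton_of_active hsupp hX ha) ha b hb

/-- **The active family of `Λ` is inside the box family** once the box contains the `R`-neighbourhood of the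
base sites of `Λ` (`‖x‖ + R ≤ n` for every base site `x` of `Λ`). [folklore] -/
theorem activeFamily_subset_boxFamily (hsupp : W.IsSupportedBy supp) {R : ℝ}
    (hrange : ∀ e, ∀ X ∈ supp {e}, e ∈ X → ∀ y ∈ X, ‖e.1 - y.1‖ ≤ R) {n : ℕ} {Λ : Finset (ZdEdge d)}
    (hn : ∀ x ∈ Λ.image Prod.fst, ‖x‖ + R ≤ n) : activeFamily W supp Λ ⊆ boxFamily W supp n := by
  intro X hX
  obtain ⟨-, ⟨e₀, he₀⟩, hX0⟩ := mem_activeFamily.1 hX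
  obtain ⟨he₀X, he₀Λ⟩ := Finset.mem_inter.1 he₀
  have hx₀ : ‖e₀.1‖ + R ≤ n := hn e₀.1 (Finset.mem_image_of_mem _ he₀Λ)
  have hbox : ∀ e ∈ X, e.1 ∈ siteBox d n := fun e he =>
    mem_siteBox_of_norm_sub_le hx₀ (diam_le_of_active hsupp hrange hX0 e₀ he₀X e he)
  refine mem_boxFamily.2 ⟨hsupp _ X ⟨e₀, Finset.mem_inter.2 ⟨he₀X, mem_boxLinks.2 (hbox e₀ he₀X)⟩⟩ hX0, hbox, hX0⟩

/-- Eventually (in the torus size `L`), the active family of `Λ` is inside the box family of radius `L / 2`.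
[folklore] -/
theorem eventually_activeFamily_subset_boxFamily (hsupp : W.IsSupportedBy supp) {R : ℝ}
    (hrange : ∀ e, ∀ X ∈ supp {e}, e ∈ X → ∀ y ∈ X, ‖e.1 - y.1‖ ≤ R) (Λ : Finset (ZdEdge d)) :
    ∀ᶠ L : ℕ in atTop, activeFamily W supp Λ ⊆ boxFamily W supp (L / 2) := by
  filter_upwards [eventually_norm_add_le (Λ.image Prod.fst) R] with L hL
  exact activeFamily_subset_boxFamily hsupp hrange hL

/-- **A box set outside the active family of `Λ` misses `Λ`** (an active set meeting `Λ` is listed in `supp Λ`).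
[folklore] -/
theorem disjoint_of_mem_boxFamily_of_not_mem_activeFamily (hsupp : W.IsSupportedBy supp) {n : ℕ}
    {Λ X : Finset (ZdEdge d)} (hX : X ∈ boxFamily W supp n) (hXΛ : X ∉ activeFamily W supp Λ) :
    Disjoint X Λ := by
  rw [Finset.disjoint_iff_inter_eq_empty, ← Finset.not_nonempty_iff_eq_empty]
  intro hne
  have hX0 := ne_zero_of_mem_boxFamily hX
  exact hXΛ (mem_activeFamily.2 ⟨hsupp Λ X hne hX0, hne, hX0⟩)

/-- The sets of the box family through a link `e` are among the listed sets through `e`. [folklore] -/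
theorem filter_mem_boxFamily_subset (hsupp : W.IsSupportedBy supp) (n : ℕ) (e : ZdEdge d) :
    (boxFamily W supp n).filter (fun X => e ∈ X) ⊆ (supp {e}).filter fun X => e ∈ X := by
  intro X hX
  obtain ⟨hXb, he⟩ := Finset.mem_filter.1 hX
  exact Finset.mem_filter.2 ⟨mem_supp_singleton_of_active hsupp (ne_zero_of_mem_boxFamily hXb) he, he⟩

/-- The sets of the box family with a link based at `v` are listed at `v` (ds-2's site incidence `listedAt`).
[folklore] -/
theorem filter_base_boxFamily_subset_listedAt (hsupp : W.IsSupportedBy supp) (n : ℕ) (v : Site d) :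
    (boxFamily W supp n).filter (fun X => v ∈ X.image Prod.fst) ⊆ listedAt supp v := by
  intro X hX
  obtain ⟨hXb, hv⟩ := Finset.mem_filter.1 hX
  obtain ⟨e, he, rfl⟩ := Finset.mem_image.1 hv
  exact mem_listedAt_of_ne_zero hsupp (ne_zero_of_mem_boxFamily hXb) he

/-- All base sites of the box family lie in the box (the hypothesis `hB` of ds-2's `chartMember_mem_clusterDomainFR`
and `injOn_torusEdge_of_base`). [folklore] -/
theorem boxFamily_base_subset {n : ℕ} : ∀ X ∈ boxFamily W supp n, ∀ e ∈ X, e.1 ∈ siteBox d n :=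
  fun _ hX _ he => base_mem_siteBox_of_mem_boxFamily hX he

/-- **Diameter bound on the box family** (the hypothesis `hR` of ds-2's `hasRange_chartMember`): every box set has
`ℓ^∞` diameter `≤ R`. [folklore] -/
theorem boxFamily_diam_le (hsupp : W.IsSupportedBy supp) {R : ℝ}
    (hrange : ∀ e, ∀ X ∈ supp {e}, e ∈ X → ∀ y ∈ X, ‖e.1 - y.1‖ ≤ R) {n : ℕ} :
    ∀ X ∈ boxFamily W supp n, ∀ a ∈ X, ∀ b ∈ X, ‖a.1 - b.1‖ ≤ R :=
  fun _ hX => diam_le_of_active hsupp hrange (ne_zero_of_mem_boxFamily hX)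

end Families

/-! ### Loads of the box family are dominated by the member's `ℤ^d` loads -/

section Loads

variable {W : Potential (ZdEdge d) (SUN N)} {supp : Finset (ZdEdge d) → Finset (Finset (ZdEdge d))}

/-- **Oscillation load of the box family `≤` the member's oscillation load** at every link (the hypothesis `h₀`
of ds-2's `chartMember_mem_clusterDomainFR`). [folklore] -/
theorem oscLoad_boxFamily_le (hsupp : W.IsSupportedBy supp) {osc : Finset (ZdEdge d) → ZdEdge d → ℝ}
    (hosc : ∀ X, Dobrushin.IsOscBound (W X) (osc X)) {ε₀ : ℝ}
    (h₀ : ∀ e, ∑ X ∈ (supp {e}).filter (fun X => e ∈ X), osc X e ≤ ε₀) (n : ℕ) (e : ZdEdge d) :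
    ∑ X ∈ (boxFamily W supp n).filter (fun X => e ∈ X), osc X e ≤ ε₀ :=
  (Finset.sum_le_sum_of_subset_of_nonneg (filter_mem_boxFamily_subset hsupp n e)
    fun X _ _ => (hosc X).nonneg e).trans (h₀ e)

/-- **Site-incidence Lipschitz load of the box family `≤` the member's** at every site (the hypothesis `h₁` of
ds-2's `chartMember_mem_clusterDomainFR`). [folklore] -/
theorem lipLoad_boxFamily_le (hsupp : W.IsSupportedBy supp) {lip : Finset (ZdEdge d) → ZdEdge d → ℝ}
    (hlip : ∀ X, IsLipBound suFrobDist (W X) (lip X)) {ε₁ : ℝ}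
    (h₁ : ∀ v : Site d, ∑ X ∈ listedAt supp v, ∑ y ∈ X, lip X y ≤ ε₁) (n : ℕ) (v : Site d) :
    ∑ X ∈ (boxFamily W supp n).filter (fun X => v ∈ X.image Prod.fst), ∑ y ∈ X, lip X y ≤ ε₁ :=
  (Finset.sum_le_sum_of_subset_of_nonneg (filter_base_boxFamily_subset_listedAt hsupp n v)
    fun X _ _ => Finset.sum_nonneg fun y _ => (hlip X).nonneg y).trans (h₁ v)

end Loads

end Summit.Ventures.YMGap.RobustBall

end
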